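import Summits.AtomisticToContinuum.Crystallization.Theses.PRVarianceCertificate
import Summits.AtomisticToContinuum.Crystallization.Theorems.PalmUnimodularRigidityLayeredLawsSelectHcpUniqueMinimiser
import Summits.AtomisticToContinuum.Crystallization.Theorems.PalmUnimodularRigidityLayeredLawsSelectHcpMinimiserEnclosure
import Summits.AtomisticToContinuum.Crystallization.Theorems.ExcessDecayLiouvilleCoarseGrainsHcpEnergySeries
import Literature.MathematicalPhysics.StatisticalMechanics.BarlowStacking

/-!
# `CoerciveVarianceCertificate` (stmt-AtomisticToContinuum-11860): the two-way matching predicate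

Helper file of route `PRVarianceCertificate`, crux `CoerciveVarianceCertificate`, line `birth`
(skeleton `Cruxes/CoerciveVarianceCertificate/Lines/birth.lean`).  The crux and its stubs
`stub_pricingLarge`, `stub_coarseToFine` speak about ONE predicate: site `i` of a configuration
`x : ι → E` is `(R, ε)`-matched to the template `S ⊆ E` when

  `∃ A : E →ₗᵢ[ℝ] E, (∀ p ∈ S, ‖p‖ ≤ R → ∃ k, dist (x k) (x i + A p) ≤ ε) ∧`
  `                   (∀ k, dist (x k) (x i) ≤ R → ∃ p ∈ S, dist (x k) (x i + A p) ≤ ε)`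

Nothing here closes the crux or a stub; the file records the elementary facts every line needs,
with the predicate inlined in exactly this shape (it applies to the registered signatures):

* `matched_mono`, `card_unmatched_mono` — `(R, ε)`-matched, `R' ≤ R`, `ε ≤ ε'` give
  `(R', ε')`-matched (same isometry), so the defect count `#{i : ¬ (R, ε)-matched}` is antitone;
  `matched_of_le_tol` — if `R ≤ ε` and `0 ∈ S` every site is matched (identity isometry);
* `coarseToFine_of_window_le`, `coarseToFine_smallWindow`, `coarseToFine_of_le_tol`, assembled
  in the registered sub-goal `coarseToFine_degenerateRegimes` — the two DEGENERATE REGIMES of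
  `stub_coarseToFine`, `R ≤ 2a ∧ a/100 ≤ ε` (the hypothesis at `j = i` is the coarse match of `i`,
  then monotonicity) and `R ≤ ε`, hold for every configuration with `L = 1`; the complement
  `ε < R ∧ (2a < R ∨ ε < a/100)` is the substance of the stub (interior regularity and scale
  pinning of Lennard-Jones ground states) and is NOT addressed;
* `exists_inner_lt_of_matched`, `not_matched_of_forall_inner_le`, `exists_not_matched` — if `S`
  `2ε`-spans every direction inside radius `R` (`∀ ν, ‖ν‖ = 1 → ∃ p ∈ S, ‖p‖ ≤ R ∧ 2ε < ⟪p, ν⟫`),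
  a matched site has a particle strictly beyond it in every direction (a linear isometry is onto
  in finite dimension), so exposed vertices are unmatched and every finite nonempty
  configuration has an unmatched site;
* `hcp_spans`, `exists_not_coarseMatched_hcp` — the spanning hypothesis for the line's template
  `hcp_{a,h}` at the coarse resolution `(2a, a/100)` when `h ≤ a ≤ 2h` (axis points
  `±a e₀, ±√3 a e₁, ±2h e₂` of `hcpStacking a h`); so the hypothesis of `stub_coarseToFine` fails
  at every site once `L ≥ diam x` — which does NOT make the stub vacuous: `L` is fixed before
  the ground state, and Lennard-Jones ground states have unbounded diameter;
* `optimalHcp_mem_box`, `optimalHcp_enclosure`, `optimalHcp_ratio` — the OPTIMAL pairs of the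
  stubs are pinned: `a, h > 0` minimising `e_LJ(hcp_{a',h'})` over `a', h' ≠ 0` IS the relaxed
  reference of crux `LayeredLawsSelectHcp` (`e = hcpE`: `hcpEnergySeries_of_eq`; uniqueness:
  `tube_hcpE_unique_minimiser`; enclosure: `tube_minimiserEnclosure`): `a = 0.97129 ± 10⁻⁴`,
  `h = 0.79294 ± 10⁻⁴`, so `h ≤ a ≤ 2h` and `exists_not_coarseMatched_of_optimal` holds under
  the stubs' own hypotheses (every nonempty cluster has a coarse-bad site).

All statements are `[folklore]` (elementary metric geometry; the matching predicate is that of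
the hinge `BulkDefectVanish`, `Theses/PRVarianceCertificate.lean`).
-/

noncomputable section

namespace Summit.AtomisticToContinuum.Crystallization.Theorems.PRVarianceCertificate.CoerciveVarianceCertificate

open scoped BigOperators InnerProductSpace
open Literature.MathematicalPhysics.StatisticalMechanics
open Summit.AtomisticToContinuum.Crystallization.Theorems.PalmUnimodularRigidity.LayeredLawsSelectHcp
  (hcpE hcpQ stub_relaxedReference tube_hcpE_unique_minimiser tube_minimiserEnclosure)
open Summit.AtomisticToContinuum.Crystallization.Theorems.ExcessDecayLiouvilleCoarseGrains
  (hcpEnergySeries_of_eq)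

/-! ## Monotonicity of the matching predicate -/

section Mono

variable {E : Type*} [SeminormedAddCommGroup E] [NormedSpace ℝ E] {ι : Type*}

/-- **Monotonicity of the two-way matching predicate.** If site `i` of `x` is `(R, ε)`-matched to
the template `S` and `R' ≤ R`, `ε ≤ ε'`, then it is `(R', ε')`-matched, by the same isometry (a
smaller window asks for fewer points and particles, a larger tolerance is easier). [folklore] -/
theorem matched_mono {S : Set E} {x : ι → E} {i : ι} {R R' ε ε' : ℝ} (hR : R' ≤ R) (hε : ε ≤ ε')
    (h : ∃ A : E →ₗᵢ[ℝ] E, (∀ p ∈ S, ‖p‖ ≤ R → ∃ k, dist (x k) (x i + A p) ≤ ε) ∧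
      (∀ k, dist (x k) (x i) ≤ R → ∃ p ∈ S, dist (x k) (x i + A p) ≤ ε)) :
    ∃ A : E →ₗᵢ[ℝ] E, (∀ p ∈ S, ‖p‖ ≤ R' → ∃ k, dist (x k) (x i + A p) ≤ ε') ∧
      (∀ k, dist (x k) (x i) ≤ R' → ∃ p ∈ S, dist (x k) (x i + A p) ≤ ε') := by
  obtain ⟨A, h₁, h₂⟩ := h
  refine ⟨A, fun p hp hpR => ?_, fun k hk => ?_⟩
  · obtain ⟨k, hk⟩ := h₁ p hp (hpR.trans hR)
    exact ⟨k, hk.trans hε⟩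
  · obtain ⟨p, hp, hpk⟩ := h₂ k (hk.trans hR)
    exact ⟨p, hp, hpk.trans hε⟩

/-- **The defect count is antitone.** For a finite configuration the number of
`(R', ε')`-unmatched sites is at most the number of `(R, ε)`-unmatched sites whenever `R' ≤ R`
and `ε ≤ ε'` (contrapositive of `matched_mono`, site by site). [folklore] -/
theorem card_unmatched_mono [Finite ι] {S : Set E} {x : ι → E} {R R' ε ε' : ℝ} (hR : R' ≤ R)
    (hε : ε ≤ ε') :
    Nat.card {i : ι // ¬ ∃ A : E →ₗᵢ[ℝ] E, (∀ p ∈ S, ‖p‖ ≤ R' → ∃ k, dist (x k) (x i + A p) ≤ ε') ∧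
      (∀ k, dist (x k) (x i) ≤ R' → ∃ p ∈ S, dist (x k) (x i + A p) ≤ ε')} ≤
    Nat.card {i : ι // ¬ ∃ A : E →ₗᵢ[ℝ] E, (∀ p ∈ S, ‖p‖ ≤ R → ∃ k, dist (x k) (x i + A p) ≤ ε) ∧
      (∀ k, dist (x k) (x i) ≤ R → ∃ p ∈ S, dist (x k) (x i + A p) ≤ ε)} :=
  Nat.card_le_card_of_injective _
    (Subtype.impEmbedding _ _ fun _ hi h' => hi (matched_mono hR hε h')).injective

/-- **Windows no larger than the tolerance are always matched.** If `R ≤ ε` and `0 ∈ S`, every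
site is `(R, ε)`-matched by the identity isometry: a template point `p` with `‖p‖ ≤ R` is realised
by `x i` itself, a particle within `R` of `x i` by the template point `0`. [folklore] -/
theorem matched_of_le_tol {S : Set E} (h0 : (0 : E) ∈ S) (x : ι → E) (i : ι) {R ε : ℝ}
    (hRε : R ≤ ε) :
    ∃ A : E →ₗᵢ[ℝ] E, (∀ p ∈ S, ‖p‖ ≤ R → ∃ k, dist (x k) (x i + A p) ≤ ε) ∧
      (∀ k, dist (x k) (x i) ≤ R → ∃ p ∈ S, dist (x k) (x i + A p) ≤ ε) :=
  ⟨LinearIsometry.id, fun p _ hpR => ⟨i, by simpa using hpR.trans hRε⟩,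
    fun k hk => ⟨0, h0, by simpa using hk.trans hRε⟩⟩

end Mono

/-! ## Points of the hcp template -/

section HcpPoints

/-- Points of the stacking are points of the hcp periodic configuration. [folklore] -/
theorem barlowPos_mem_hcpPeriodicConfiguration {a h : ℝ} (ha : a ≠ 0) (hh : h ≠ 0) (k i j : ℤ) :
    barlowPos a h alternatingHagg k i j ∈ (hcpPeriodicConfiguration ha hh).points := by
  rw [hcpPeriodicConfiguration_points]
  exact barlowPos_mem k i j

/-- The origin `barlowPos 0 0 0` is a point of the hcp periodic configuration. [folklore] -/
theorem zero_mem_hcpPeriodicConfiguration {a h : ℝ} (ha : a ≠ 0) (hh : h ≠ 0) :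
    (0 : EuclideanSpace ℝ (Fin 3)) ∈ (hcpPeriodicConfiguration ha hh).points := by
  convert barlowPos_mem_hcpPeriodicConfiguration ha hh 0 0 0 using 1
  simp [barlowPos]

end HcpPoints

/-! ## The degenerate regimes of `stub_coarseToFine`: `R ≤ 2a ∧ a/100 ≤ ε`, and `R ≤ ε` -/

section SmallWindow

/-- **Coarse-to-fine below the coarse resolution, at any radius.** If `R ≤ 2a`, `a/100 ≤ ε` and
every particle within `L ≥ 0` of `x i` has its `2a`-window `(a/100)`-matched to `hcp_{a,h}`, then
the `R`-window at `x i` is `ε`-matched: the hypothesis at `j = i` and `matched_mono`. [folklore] -/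
theorem coarseToFine_of_window_le {a h : ℝ} (ha : 0 < a) (hh : 0 < h) {R ε L : ℝ}
    (hR : R ≤ 2 * a) (hε : a / 100 ≤ ε) (hL : 0 ≤ L) {N : ℕ}
    {x : Fin N → EuclideanSpace ℝ (Fin 3)} {i : Fin N}
    (hyp : ∀ j : Fin N, dist (x j) (x i) ≤ L → (∃ A : EuclideanSpace ℝ (Fin 3) →ₗᵢ[ℝ] EuclideanSpace ℝ (Fin 3), (∀ p ∈ (Literature.MathematicalPhysics.StatisticalMechanics.hcpPeriodicConfiguration ha.ne' hh.ne').points, ‖p‖ ≤ 2 * a → ∃ k : Fin N, dist (x k) (x j + A p) ≤ a / 100) ∧ (∀ k : Fin N, dist (x k) (x j) ≤ 2 * a → ∃ p ∈ (Literature.MathematicalPhysics.StatisticalMechanics.hcpPeriodicConfiguration ha.ne' hh.ne').points, dist (x k) (x j + A p) ≤ a / 100))) :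
    ∃ A : EuclideanSpace ℝ (Fin 3) →ₗᵢ[ℝ] EuclideanSpace ℝ (Fin 3), (∀ p ∈ (Literature.MathematicalPhysics.StatisticalMechanics.hcpPeriodicConfiguration ha.ne' hh.ne').points, ‖p‖ ≤ R → ∃ k : Fin N, dist (x k) (x i + A p) ≤ ε) ∧ (∀ k : Fin N, dist (x k) (x i) ≤ R → ∃ p ∈ (Literature.MathematicalPhysics.StatisticalMechanics.hcpPeriodicConfiguration ha.ne' hh.ne').points, dist (x k) (x i + A p) ≤ ε) :=
  matched_mono hR hε (hyp i (by rw [dist_self]; exact hL))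

/-- **`stub_coarseToFine` in the regime `R ≤ 2a ∧ a/100 ≤ ε`.** The conclusion of
`stub_coarseToFine` (the part after `∀ R ε, 0 < R → 0 < ε →`, verbatim) holds with `L = 1`, for
every configuration (the ground-state hypothesis is not used): `coarseToFine_of_window_le`.
[folklore] -/
theorem coarseToFine_smallWindow {a h : ℝ} (ha : 0 < a) (hh : 0 < h) {R ε : ℝ}
    (hR : R ≤ 2 * a) (hε : a / 100 ≤ ε) :
    ∃ L : ℝ, 0 < L ∧ ∀ (N : ℕ) (x : Fin N → EuclideanSpace ℝ (Fin 3)), Literature.MathematicalPhysics.StatisticalMechanics.IsGroundState Literature.MathematicalPhysics.StatisticalMechanics.lennardJones x → ∀ i : Fin N, (∀ j : Fin N, dist (x j) (x i) ≤ L → (∃ A : EuclideanSpace ℝ (Fin 3) →ₗᵢ[ℝ] EuclideanSpace ℝ (Fin 3), (∀ p ∈ (Literature.MathematicalPhysics.StatisticalMechanics.hcpPeriodicConfiguration ha.ne' hh.ne').points, ‖p‖ ≤ 2 * a → ∃ k : Fin N, dist (x k) (x j + A p) ≤ a / 100) ∧ (∀ k : Fin N, dist (x k) (x j) ≤ 2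 * a → ∃ p ∈ (Literature.MathematicalPhysics.StatisticalMechanics.hcpPeriodicConfiguration ha.ne' hh.ne').points, dist (x k) (x j + A p) ≤ a / 100))) → (∃ A : EuclideanSpace ℝ (Fin 3) →ₗᵢ[ℝ] EuclideanSpace ℝ (Fin 3), (∀ p ∈ (Literature.MathematicalPhysics.StatisticalMechanics.hcpPeriodicConfiguration ha.ne' hh.ne').points, ‖p‖ ≤ R → ∃ k : Fin N, dist (x k) (x i + A p) ≤ ε) ∧ (∀ k : Fin N, dist (x k) (x i) ≤ R → ∃ p ∈ (Literature.MathematicalPhysics.StatisticalMechanics.hcpPeriodicConfiguration ha.ne' hh.ne').points, dist (x k) (x i + A p) ≤ ε)) :=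
  ⟨1, one_pos, fun _ _ _ _ hyp => coarseToFine_of_window_le ha hh hR hε zero_le_one hyp⟩

/-- **`stub_coarseToFine` in the regime `R ≤ ε`.** The same conclusion holds with `L = 1` for
every configuration when the window is no larger than the tolerance (`matched_of_le_tol` with
`0 ∈ hcp_{a,h}`; neither the coarse hypothesis nor the ground-state property is used).
[folklore] -/
theorem coarseToFine_of_le_tol {a h : ℝ} (ha : 0 < a) (hh : 0 < h) {R ε : ℝ} (hRε : R ≤ ε) :
    ∃ L : ℝ, 0 < L ∧ ∀ (N : ℕ) (x : Fin N → EuclideanSpace ℝ (Fin 3)), Literature.MathematicalPhysics.StatisticalMechanics.IsGroundState Literature.MathematicalPhysics.StatisticalMechanics.lennardJones x → ∀ i : Fin N, (∀ j : Fin N, dist (x j) (x i) ≤ L → (∃ A : EuclideanSpace ℝ (Fin 3) →ₗᵢ[ℝ] EuclideanSpace ℝ (Fin 3), (∀ p ∈ (Literature.MathematicalPhysics.StatisticalMechanics.hcpPeriodicConfiguration ha.ne' hh.ne').points, ‖p‖ ≤ 2 * a → ∃ k : Fin N, dist (x k) (x j + A p) ≤ a / 100) ∧ (∀ k : Fin N,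 dist (x k) (x j) ≤ 2 * a → ∃ p ∈ (Literature.MathematicalPhysics.StatisticalMechanics.hcpPeriodicConfiguration ha.ne' hh.ne').points, dist (x k) (x j + A p) ≤ a / 100))) → (∃ A : EuclideanSpace ℝ (Fin 3) →ₗᵢ[ℝ] EuclideanSpace ℝ (Fin 3), (∀ p ∈ (Literature.MathematicalPhysics.StatisticalMechanics.hcpPeriodicConfiguration ha.ne' hh.ne').points, ‖p‖ ≤ R → ∃ k : Fin N, dist (x k) (x i + A p) ≤ ε) ∧ (∀ k : Fin N, dist (x k) (x i) ≤ R → ∃ p ∈ (Literature.MathematicalPhysics.StatisticalMechanics.hcpPeriodicConfiguration ha.ne' hh.ne').points, dist (x k) (x i + A p) ≤ ε)) :=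
  ⟨1, one_pos, fun _ x _ i _ =>
    matched_of_le_tol (zero_mem_hcpPeriodicConfiguration ha.ne' hh.ne') x i hRε⟩

/-- **Registered sub-goal `coarseToFine_degenerateRegimes` of stub `stub_coarseToFine`** (line
`birth`, crux `CoerciveVarianceCertificate`, stmt-AtomisticToContinuum-11860): the stub's conclusion
(verbatim) in its two degenerate regimes `R ≤ 2a ∧ a/100 ≤ ε` and `R ≤ ε`, for every `a, h > 0`
(optimality, `0 < R`, `0 < ε` and the ground-state property are not needed).  The complementary
regime `ε < R ∧ (2a < R ∨ ε < a/100)` is the open content of the stub. [folklore] -/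
theorem coarseToFine_degenerateRegimes : ∀ (a h : ℝ) (ha : 0 < a) (hh : 0 < h) (R ε : ℝ), (R ≤ 2 * a ∧ a / 100 ≤ ε) ∨ R ≤ ε → ∃ L : ℝ, 0 < L ∧ ∀ (N : ℕ) (x : Fin N → EuclideanSpace ℝ (Fin 3)), Literature.MathematicalPhysics.StatisticalMechanics.IsGroundState Literature.MathematicalPhysics.StatisticalMechanics.lennardJones x → ∀ i : Fin N, (∀ j : Fin N, dist (x j) (x i) ≤ L → (∃ A : EuclideanSpace ℝ (Fin 3) →ₗᵢ[ℝ] EuclideanSpace ℝ (Fin 3), (∀ p ∈ (Literature.MathematicalPhysics.StatisticalMechanics.hcpPeriodicConfiguration ha.ne' hh.ne').points, ‖p‖ ≤ 2 * a → ∃ k : Fin N, dist (x k) (x j + A p) ≤ a / 100) ∧ (∀ k : Fin N, dist (x k) (x j) ≤ 2 * a → ∃ p ∈ (Literature.MathematicalPhysics.StatisticalMechanics.hcpPeriodicConfiguration ha.ne' hh.ne').points, dist (x k) (x j + A p) ≤ a / 100))) → (∃ A : EuclideanSpace ℝ (Fin 3) →ₗᵢ[ℝ] EuclideanSpace ℝ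 (Fin 3), (∀ p ∈ (Literature.MathematicalPhysics.StatisticalMechanics.hcpPeriodicConfiguration ha.ne' hh.ne').points, ‖p‖ ≤ R → ∃ k : Fin N, dist (x k) (x i + A p) ≤ ε) ∧ (∀ k : Fin N, dist (x k) (x i) ≤ R → ∃ p ∈ (Literature.MathematicalPhysics.StatisticalMechanics.hcpPeriodicConfiguration ha.ne' hh.ne').points, dist (x k) (x i + A p) ≤ ε)) :=
  fun _ _ ha hh _ _ hreg => hreg.elim (fun h₂ => coarseToFine_smallWindow ha hh h₂.1 h₂.2)
    fun h₁ => coarseToFine_of_le_tol ha hh h₁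

end SmallWindow

/-! ## Extreme points are unmatched -/

section Extreme

variable {F : Type*} [NormedAddCommGroup F] [InnerProductSpace ℝ F] [FiniteDimensional ℝ F]
  {ι : Type*}

/-- **A matched site has a particle strictly beyond it in every direction.** Suppose the template
`S` `2ε`-spans every direction inside radius `R`: for every unit vector `ν` some `p ∈ S` with
`‖p‖ ≤ R` has `⟪p, ν⟫ > 2ε`.  If every template point of the `R`-window at `x i` is `ε`-realised
(`∀ p ∈ S, ‖p‖ ≤ R → ∃ k, dist (x k) (x i + A p) ≤ ε`, the first half of the matching predicate)
then for every unit `ν` some particle has `⟪x k, ν⟫ > ⟪x i, ν⟫ + ε`: a linear isometry of a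
finite-dimensional space is onto, so `ν = A μ`, `‖μ‖ = 1`; take `p` for `μ` and the particle `k`
realising `A p`: `⟪x k, ν⟫ ≥ ⟪x i, ν⟫ + ⟪p, μ⟫ - ε`. [folklore] -/
theorem exists_inner_lt_of_matched {S : Set F} {x : ι → F} {i : ι} {R ε : ℝ}
    (hS : ∀ ν : F, ‖ν‖ = 1 → ∃ p ∈ S, ‖p‖ ≤ R ∧ 2 * ε < ⟪p, ν⟫_ℝ)
    {A : F →ₗᵢ[ℝ] F} (hA : ∀ p ∈ S, ‖p‖ ≤ R → ∃ k, dist (x k) (x i + A p) ≤ ε)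
    (ν : F) (hν : ‖ν‖ = 1) : ∃ k, ⟪x i, ν⟫_ℝ + ε < ⟪x k, ν⟫_ℝ := by
  set A' : F ≃ₗᵢ[ℝ] F := A.toLinearIsometryEquiv rfl with hA'
  obtain ⟨p, hp, hpR, hpν⟩ := hS (A'.symm ν) (by rw [LinearIsometryEquiv.norm_map, hν])
  obtain ⟨k, hk⟩ := hA p hp hpR
  have h1 : ⟪A p, ν⟫_ℝ = ⟪p, A'.symm ν⟫_ℝ := by
    rw [← A'.inner_map_map p (A'.symm ν), LinearIsometryEquiv.apply_symm_apply, hA',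
      LinearIsometry.coe_toLinearIsometryEquiv]
  have h2 : |⟪x k - (x i + A p), ν⟫_ℝ| ≤ ε :=
    calc |⟪x k - (x i + A p), ν⟫_ℝ| ≤ ‖x k - (x i + A p)‖ * ‖ν‖ := abs_real_inner_le_norm _ _
      _ ≤ ε := by rw [hν, mul_one, ← dist_eq_norm]; exact hk
  have h3 : ⟪x k, ν⟫_ℝ = ⟪x i, ν⟫_ℝ + ⟪A p, ν⟫_ℝ + ⟪x k - (x i + A p), ν⟫_ℝ := by
    rw [inner_sub_left, inner_add_left]; ring
  exact ⟨k, by rw [h3, h1]; linarith [(abs_le.1 h2).1]⟩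

/-- **Extreme points are unmatched.** Under the spanning hypothesis of
`exists_inner_lt_of_matched`, a site `i` maximising `k ↦ ⟪x k, ν⟫` for some unit vector `ν` (a
vertex of the convex hull exposed by `ν`) is NOT `(R, ε)`-matched to `S`. [folklore] -/
theorem not_matched_of_forall_inner_le {S : Set F} {x : ι → F} {i : ι} {R ε : ℝ}
    (hS : ∀ ν : F, ‖ν‖ = 1 → ∃ p ∈ S, ‖p‖ ≤ R ∧ 2 * ε < ⟪p, ν⟫_ℝ)
    {ν : F} (hν : ‖ν‖ = 1) (hmax : ∀ k, ⟪x k, ν⟫_ℝ ≤ ⟪x i, ν⟫_ℝ) :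
    ¬ ∃ A : F →ₗᵢ[ℝ] F, (∀ p ∈ S, ‖p‖ ≤ R → ∃ k, dist (x k) (x i + A p) ≤ ε) ∧
      (∀ k, dist (x k) (x i) ≤ R → ∃ p ∈ S, dist (x k) (x i + A p) ≤ ε) := by
  rintro ⟨A, hA, -⟩
  have hε : 0 ≤ ε := by
    obtain ⟨p, hp, hpR, -⟩ := hS ν hν
    obtain ⟨k, hk⟩ := hA p hp hpR
    exact dist_nonneg.trans hk
  obtain ⟨k, hk⟩ := exists_inner_lt_of_matched hS hA ν hν
  linarith [hmax k]

/-- **Every finite nonempty configuration has an unmatched site** under the spanning hypothesis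
(given one unit vector `ν`: the maximiser of `k ↦ ⟪x k, ν⟫` is unmatched). [folklore] -/
theorem exists_not_matched [Finite ι] [Nonempty ι] {S : Set F} (x : ι → F) {R ε : ℝ}
    (hS : ∀ ν : F, ‖ν‖ = 1 → ∃ p ∈ S, ‖p‖ ≤ R ∧ 2 * ε < ⟪p, ν⟫_ℝ) {ν : F} (hν : ‖ν‖ = 1) :
    ∃ i, ¬ ∃ A : F →ₗᵢ[ℝ] F, (∀ p ∈ S, ‖p‖ ≤ R → ∃ k, dist (x k) (x i + A p) ≤ ε) ∧
      (∀ k, dist (x k) (x i) ≤ R → ∃ p ∈ S, dist (x k) (x i + A p) ≤ ε) := by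
  obtain ⟨i, hi⟩ := Finite.exists_max fun k => ⟪x k, ν⟫_ℝ
  exact ⟨i, not_matched_of_forall_inner_le hS hν hi⟩

end Extreme

/-! ## The hcp template spans every direction at the coarse resolution -/

section Hcp

/-- **The hcp template `a/2`-spans every direction inside radius `2a`** when `h ≤ a ≤ 2h`: for
every unit vector `ν` one of the six points `±a e₀ = barlowPos 0 (±1) 0`,
`±√3 a e₁ = barlowPos 0 (∓1) (±2)`, `±2h e₂ = barlowPos (±2) 0 0` of `hcpStacking a h` (norms
`a`, `√3 a`, `2h`, all `≤ 2a`) has inner product `≥ a/2` with `ν` (one of `ν₀² ≥ 1/4`,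
`ν₁² ≥ 1/12`, `ν₂² ≥ 1/4` holds since `1/4 + 1/12 + 1/4 < 1`); the optimal Lennard-Jones pair
has `h/a ≈ √(2/3)` (`optimalHcp_ratio`). [folklore] -/
theorem hcp_spans {a h : ℝ} (ha : 0 < a) (hh : 0 < h) (hha : h ≤ a) (hah : a ≤ 2 * h)
    (ν : EuclideanSpace ℝ (Fin 3)) (hν : ‖ν‖ = 1) :
    ∃ p ∈ (hcpPeriodicConfiguration ha.ne' hh.ne').points, ‖p‖ ≤ 2 * a ∧ a / 2 ≤ ⟪p, ν⟫_ℝ := by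
  have hunit : ν 0 ^ 2 + ν 1 ^ 2 + ν 2 ^ 2 = 1 := by
    have := EuclideanSpace.real_norm_sq_eq ν
    rw [hν, Fin.sum_univ_three] at this
    linarith
  -- the six candidate points `±a e₀, ±√3 a e₁, ±2h e₂`: inner products with `ν` and norms
  have hin₀ : ∀ σ : ℤ, ⟪barlowPos a h alternatingHagg 0 σ 0, ν⟫_ℝ = σ * (a * ν 0) := fun σ => by
    simp [PiLp.inner_apply, Fin.sum_univ_three]; ring
  have hsq₀ : ∀ σ : ℤ, σ ^ 2 = 1 → ‖barlowPos a h alternatingHagg 0 σ 0‖ ≤ 2 * a := fun σ hσ => by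
    have hσ' : (σ : ℝ) ^ 2 = 1 := by exact_mod_cast hσ
    have : ‖barlowPos a h alternatingHagg 0 σ 0‖ ^ 2 = a ^ 2 := by
      rw [EuclideanSpace.real_norm_sq_eq, Fin.sum_univ_three]
      simp
      linear_combination a ^ 2 * hσ'
    nlinarith [norm_nonneg (barlowPos a h alternatingHagg 0 σ 0)]
  have hin₁ : ∀ σ : ℤ, ⟪barlowPos a h alternatingHagg 0 (-σ) (2 * σ), ν⟫_ℝ = σ * (a * √3 * ν 1) :=
    fun σ => by simp [PiLp.inner_apply, Fin.sum_univ_three]; ring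
  have hsq₁ : ∀ σ : ℤ, σ ^ 2 = 1 → ‖barlowPos a h alternatingHagg 0 (-σ) (2 * σ)‖ ≤ 2 * a :=
    fun σ hσ => by
    have hσ' : (σ : ℝ) ^ 2 = 1 := by exact_mod_cast hσ
    have h3 : (√3 : ℝ) ^ 2 = 3 := Real.sq_sqrt (by norm_num)
    have : ‖barlowPos a h alternatingHagg 0 (-σ) (2 * σ)‖ ^ 2 = 3 * a ^ 2 := by
      rw [EuclideanSpace.real_norm_sq_eq, Fin.sum_univ_three]
      simp
      linear_combination a ^ 2 * σ ^ 2 * h3 + 3 * a ^ 2 * hσ'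
    nlinarith [norm_nonneg (barlowPos a h alternatingHagg 0 (-σ) (2 * σ))]
  have hin₂ : ∀ σ : ℤ, Even σ → ⟪barlowPos a h alternatingHagg σ 0 0, ν⟫_ℝ = σ * (h * ν 2) :=
    fun σ hσ => by simp [PiLp.inner_apply, Fin.sum_univ_three, haggLabel_alternating, hσ]; ring
  have hsq₂ : ∀ σ : ℤ, Even σ → σ ^ 2 = 4 → ‖barlowPos a h alternatingHagg σ 0 0‖ ≤ 2 * a :=
    fun σ hσ hσ4 => by
    have hσ' : (σ : ℝ) ^ 2 = 4 := by exact_mod_cast hσ4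
    have : ‖barlowPos a h alternatingHagg σ 0 0‖ ^ 2 = 4 * h ^ 2 := by
      rw [EuclideanSpace.real_norm_sq_eq, Fin.sum_univ_three]
      simp [haggLabel_alternating, hσ]
      linear_combination h ^ 2 * hσ'
    nlinarith [norm_nonneg (barlowPos a h alternatingHagg σ 0 0)]
  by_cases h0 : 1 / 4 ≤ ν 0 ^ 2
  · rcases le_or_gt 0 (ν 0) with hs | hs
    · refine ⟨_, barlowPos_mem_hcpPeriodicConfiguration ha.ne' hh.ne' 0 1 0, hsq₀ 1 (by norm_num),
        ?_⟩
      rw [hin₀]; push_cast; nlinarith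
    · refine ⟨_, barlowPos_mem_hcpPeriodicConfiguration ha.ne' hh.ne' 0 (-1) 0,
        hsq₀ (-1) (by norm_num), ?_⟩
      rw [hin₀]; push_cast; nlinarith
  by_cases h1 : 1 / 12 ≤ ν 1 ^ 2
  · have h3 : (√3 : ℝ) ^ 2 = 3 := Real.sq_sqrt (by norm_num)
    have h3' : (0 : ℝ) ≤ √3 := Real.sqrt_nonneg 3
    rcases le_or_gt 0 (ν 1) with hs | hs
    · have ht : 1 / 2 ≤ √3 * ν 1 :=
        (pow_le_pow_iff_left₀ (by norm_num) (mul_nonneg h3' hs) two_ne_zero).1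
          (by rw [mul_pow, h3]; linarith)
      refine ⟨_, barlowPos_mem_hcpPeriodicConfiguration ha.ne' hh.ne' 0 (-1) (2 * 1),
        hsq₁ 1 (by norm_num), ?_⟩
      rw [hin₁]; push_cast
      nlinarith [mul_le_mul_of_nonneg_left ht ha.le]
    · have ht : 1 / 2 ≤ √3 * (-ν 1) :=
        (pow_le_pow_iff_left₀ (by norm_num) (mul_nonneg h3' (neg_nonneg.2 hs.le)) two_ne_zero).1
          (by rw [mul_pow, h3, neg_sq]; linarith)
      refine ⟨_, barlowPos_mem_hcpPeriodicConfiguration ha.ne' hh.ne' 0 (-(-1)) (2 * (-1)),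
        hsq₁ (-1) (by norm_num), ?_⟩
      rw [hin₁]; push_cast
      nlinarith [mul_le_mul_of_nonneg_left ht ha.le]
  have h2 : 1 / 4 ≤ ν 2 ^ 2 := by linarith [not_le.1 h0, not_le.1 h1]
  rcases le_or_gt 0 (ν 2) with hs | hs
  · refine ⟨_, barlowPos_mem_hcpPeriodicConfiguration ha.ne' hh.ne' 2 0 0,
      hsq₂ 2 even_two (by norm_num), ?_⟩
    rw [hin₂ 2 even_two]; push_cast; nlinarith
  · refine ⟨_, barlowPos_mem_hcpPeriodicConfiguration ha.ne' hh.ne' (-2) 0 0,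
      hsq₂ (-2) (by decide) (by norm_num), ?_⟩
    rw [hin₂ (-2) (by decide)]; push_cast; nlinarith

/-- **The hcp template `a/50`-spans every direction at the coarse resolution `(2a, a/100)`**
(`h ≤ a ≤ 2h`; from `hcp_spans`, `a/50 < a/2`). [folklore] -/
theorem hcp_spans_coarse {a h : ℝ} (ha : 0 < a) (hh : 0 < h) (hha : h ≤ a) (hah : a ≤ 2 * h) :
    ∀ ν : EuclideanSpace ℝ (Fin 3), ‖ν‖ = 1 →
      ∃ p ∈ (hcpPeriodicConfiguration ha.ne' hh.ne').points, ‖p‖ ≤ 2 * a ∧ 2 * (a / 100) < ⟪p, ν⟫_ℝ :=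
  fun ν hν => (hcp_spans ha hh hha hah ν hν).imp fun _ ⟨hp, hpR, hpν⟩ => ⟨hp, hpR, by linarith⟩

/-- **Every nonempty cluster has a coarse-bad site** (`h ≤ a ≤ 2h`): in any configuration of
`N ≥ 1` particles some `2a`-window is not `(a/100)`-matched to `hcp_{a,h}` (the site farthest in
the direction `e₀`); so the hypothesis of `stub_coarseToFine` fails at every `i` once
`L ≥ diam x` (not a vacuity of the stub: `L` is fixed before `x`). [folklore] -/
theorem exists_not_coarseMatched_hcp {a h : ℝ} (ha : 0 < a) (hh : 0 < h) (hha : h ≤ a)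
    (hah : a ≤ 2 * h) {N : ℕ} [NeZero N] (x : Fin N → EuclideanSpace ℝ (Fin 3)) :
    ∃ i : Fin N, ¬ (∃ A : EuclideanSpace ℝ (Fin 3) →ₗᵢ[ℝ] EuclideanSpace ℝ (Fin 3), (∀ p ∈ (Literature.MathematicalPhysics.StatisticalMechanics.hcpPeriodicConfiguration ha.ne' hh.ne').points, ‖p‖ ≤ 2 * a → ∃ k : Fin N, dist (x k) (x i + A p) ≤ a / 100) ∧ (∀ k : Fin N, dist (x k) (x i) ≤ 2 * a → ∃ p ∈ (Literature.MathematicalPhysics.StatisticalMechanics.hcpPeriodicConfiguration ha.ne' hh.ne').points, dist (x k) (x i + A p) ≤ a / 100)) :=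
  exists_not_matched x (hcp_spans_coarse ha hh hha hah) (ν := EuclideanSpace.single 0 1) (by simp)

end Hcp

/-! ## The optimal pair is pinned: `h ≤ a ≤ 2h` under the stubs' own hypotheses -/

section Optimal

/-- `e_LJ(hcp_{a,h}) = hcpE a h` for `a, h ≠ 0` (third clause of the landed series theorem
`hcpEnergySeries_of_eq`; its right-hand side is `hcpE a h` by `rfl`). [folklore] -/
theorem energyPerParticle_hcp_eq_hcpE {a h : ℝ} (ha : a ≠ 0) (hh : h ≠ 0) :
    (hcpPeriodicConfiguration ha hh).energyPerParticle lennardJones = hcpE a h :=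
  (hcpEnergySeries_of_eq a h ha hh hcpQ rfl).2.2

/-- **Optimal pairs lie in the reference box.** If `a, h > 0` minimise the Lennard-Jones energy per
particle of `hcp_{a',h'}` over all `a', h' ≠ 0` (the optimality hypothesis of the stubs), then
`189/200 ≤ a ≤ 199/200` and `77/100 ≤ h ≤ 163/200`: `(a, h)` has the same `hcpE` as the landed
global minimiser of `stub_relaxedReference`, hence equals it (`tube_hcpE_unique_minimiser`).
[folklore] -/
theorem optimalHcp_mem_box {a h : ℝ} (ha : 0 < a) (hh : 0 < h)
    (hopt : ∀ (a' h' : ℝ) (ha' : a' ≠ 0) (hh' : h' ≠ 0), (Literature.MathematicalPhysics.StatisticalMechanics.hcpPeriodicConfiguration ha.ne' hh.ne').energyPerParticle Literature.MathematicalPhysics.StatisticalMechanics.lennardJones ≤ (Literature.MathematicalPhysics.StatisticalMechanics.hcpPeriodicConfiguration ha' hh').energyPerParticle Literature.MathematicalPhysics.StatisticalMechanics.lennardJones) :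
    189 / 200 ≤ a ∧ a ≤ 199 / 200 ∧ 77 / 100 ≤ h ∧ h ≤ 163 / 200 := by
  obtain ⟨a₀, h₀, ha₁, ha₂, hh₁, hh₂, hmin⟩ := stub_relaxedReference
  have ha0 : 0 < a₀ := by linarith
  have hh0 : 0 < h₀ := by linarith
  have hle : hcpE a h ≤ hcpE a₀ h₀ := by
    rw [← energyPerParticle_hcp_eq_hcpE ha.ne' hh.ne',
      ← energyPerParticle_hcp_eq_hcpE ha0.ne' hh0.ne']
    exact hopt a₀ h₀ ha0.ne' hh0.ne'
  obtain ⟨rfl, rfl⟩ :=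
    tube_hcpE_unique_minimiser a₀ h₀ a h ha0 hh0 ha hh hmin (le_antisymm hle (hmin a h ha hh))
  exact ⟨ha₁, ha₂, hh₁, hh₂⟩

/-- **Optimal pairs are enclosed to `10⁻⁴`.** Under the same optimality hypothesis,
`|a - 0.97129| ≤ 10⁻⁴` and `|h - 0.79294| ≤ 10⁻⁴` (`tube_minimiserEnclosure` on the box of
`optimalHcp_mem_box`). [folklore] -/
theorem optimalHcp_enclosure {a h : ℝ} (ha : 0 < a) (hh : 0 < h)
    (hopt : ∀ (a' h' : ℝ) (ha' : a' ≠ 0) (hh' : h' ≠ 0), (Literature.MathematicalPhysics.StatisticalMechanics.hcpPeriodicConfiguration ha.ne' hh.ne').energyPerParticle Literature.MathematicalPhysics.StatisticalMechanics.lennardJones ≤ (Literature.MathematicalPhysics.StatisticalMechanics.hcpPeriodicConfiguration ha' hh').energyPerParticle Literature.MathematicalPhysics.StatisticalMechanics.lennardJones) :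
    |a - 97129 / 100000| ≤ 1 / 10000 ∧ |h - 79294 / 100000| ≤ 1 / 10000 := by
  obtain ⟨ha₁, ha₂, hh₁, hh₂⟩ := optimalHcp_mem_box ha hh hopt
  refine tube_minimiserEnclosure a h ha₁ ha₂ hh₁ hh₂ fun a' h' ha' hh' => ?_
  rw [← energyPerParticle_hcp_eq_hcpE ha.ne' hh.ne',
    ← energyPerParticle_hcp_eq_hcpE ha'.ne' hh'.ne']
  exact hopt a' h' ha'.ne' hh'.ne'

/-- **`h ≤ a ≤ 2h` at every optimal pair** (from the box: `h ≤ 163/200 < 189/200 ≤ a` and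
`a ≤ 199/200 < 154/100 ≤ 2h`), the side condition of `hcp_spans`. [folklore] -/
theorem optimalHcp_ratio {a h : ℝ} (ha : 0 < a) (hh : 0 < h)
    (hopt : ∀ (a' h' : ℝ) (ha' : a' ≠ 0) (hh' : h' ≠ 0), (Literature.MathematicalPhysics.StatisticalMechanics.hcpPeriodicConfiguration ha.ne' hh.ne').energyPerParticle Literature.MathematicalPhysics.StatisticalMechanics.lennardJones ≤ (Literature.MathematicalPhysics.StatisticalMechanics.hcpPeriodicConfiguration ha' hh').energyPerParticle Literature.MathematicalPhysics.StatisticalMechanics.lennardJones) :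
    h ≤ a ∧ a ≤ 2 * h := by
  obtain ⟨ha₁, ha₂, hh₁, hh₂⟩ := optimalHcp_mem_box ha hh hopt
  constructor <;> linarith

/-- **Exposed vertices are coarse-bad, at every optimal pair**: in ANY configuration a site
maximising `k ↦ ⟪x k, ν⟫` (`‖ν‖ = 1`) has its `2a`-window not `(a/100)`-matched. [folklore] -/
theorem not_coarseMatched_of_optimal_of_forall_inner_le {a h : ℝ} (ha : 0 < a) (hh : 0 < h)
    (hopt : ∀ (a' h' : ℝ) (ha' : a' ≠ 0) (hh' : h' ≠ 0), (Literature.MathematicalPhysics.StatisticalMechanics.hcpPeriodicConfiguration ha.ne' hh.ne').energyPerParticle Literature.MathematicalPhysics.StatisticalMechanics.lennardJones ≤ (Literature.MathematicalPhysics.StatisticalMechanics.hcpPeriodicConfiguration ha' hh').energyPerParticle Literature.MathematicalPhysics.StatisticalMechanics.lennardJones)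
    {N : ℕ} {x : Fin N → EuclideanSpace ℝ (Fin 3)} {i : Fin N} {ν : EuclideanSpace ℝ (Fin 3)}
    (hν : ‖ν‖ = 1) (hmax : ∀ k, ⟪x k, ν⟫_ℝ ≤ ⟪x i, ν⟫_ℝ) :
    ¬ (∃ A : EuclideanSpace ℝ (Fin 3) →ₗᵢ[ℝ] EuclideanSpace ℝ (Fin 3), (∀ p ∈ (Literature.MathematicalPhysics.StatisticalMechanics.hcpPeriodicConfiguration ha.ne' hh.ne').points, ‖p‖ ≤ 2 * a → ∃ k : Fin N, dist (x k) (x i + A p) ≤ a / 100) ∧ (∀ k : Fin N, dist (x k) (x i) ≤ 2 * a → ∃ p ∈ (Literature.MathematicalPhysics.StatisticalMechanics.hcpPeriodicConfiguration ha.ne' hh.ne').points, dist (x k) (x i + A p) ≤ a / 100)) :=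
  not_matched_of_forall_inner_le
    (hcp_spans_coarse ha hh (optimalHcp_ratio ha hh hopt).1 (optimalHcp_ratio ha hh hopt).2) hν hmax

/-- **Every nonempty cluster has a coarse-bad site, at every optimal pair** — the defect count
of `stub_pricingLarge` is `≥ 1` on every ground state, and the hypothesis of `stub_coarseToFine`
fails at every site once `L` exceeds the diameter. [folklore] -/
theorem exists_not_coarseMatched_of_optimal {a h : ℝ} (ha : 0 < a) (hh : 0 < h)
    (hopt : ∀ (a' h' : ℝ) (ha' : a' ≠ 0) (hh' : h' ≠ 0), (Literature.MathematicalPhysics.StatisticalMechanics.hcpPeriodicConfiguration ha.ne' hh.ne').energyPerParticle Literature.MathematicalPhysics.StatisticalMechanics.lennardJones ≤ (Literature.MathematicalPhysics.StatisticalMechanics.hcpPeriodicConfiguration ha' hh').energyPerParticle Literature.MathematicalPhysics.StatisticalMechanics.lennardJones)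
    {N : ℕ} [NeZero N] (x : Fin N → EuclideanSpace ℝ (Fin 3)) :
    ∃ i : Fin N, ¬ (∃ A : EuclideanSpace ℝ (Fin 3) →ₗᵢ[ℝ] EuclideanSpace ℝ (Fin 3), (∀ p ∈ (Literature.MathematicalPhysics.StatisticalMechanics.hcpPeriodicConfiguration ha.ne' hh.ne').points, ‖p‖ ≤ 2 * a → ∃ k : Fin N, dist (x k) (x i + A p) ≤ a / 100) ∧ (∀ k : Fin N, dist (x k) (x i) ≤ 2 * a → ∃ p ∈ (Literature.MathematicalPhysics.StatisticalMechanics.hcpPeriodicConfiguration ha.ne' hh.ne').points, dist (x k) (x i + A p) ≤ a / 100)) :=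
  exists_not_coarseMatched_hcp ha hh (optimalHcp_ratio ha hh hopt).1
    (optimalHcp_ratio ha hh hopt).2 x

end Optimal

end Summit.AtomisticToContinuum.Crystallization.Theorems.PRVarianceCertificate.CoerciveVarianceCertificate
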